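import Summits.QuantumFields.YangMills.Theorems.LuscherReductionRunningReductionCoarseUpperCopies
import HarnessLib

/-!
# INNER NO-INTRUDER WITH RATE: the eight-copies step carries the rate — `I₁(L)` with tolerance `e^{C·λ_b(L³β)²}` ⟹ `I(L)` with tolerance
# `e^{C'·λ_b(L³β)²}` (crux `FixedLatticeLaw` stmt-QuantumFields-23943 ≡ leaf `FemtoGapFixedLattice`, route `FemtoCutoffLadder`; the `O(λ_b²)`
# re-run of route RED's `innerNoIntruderAt_of_oneOrbit`, `…RunningReductionCoarseUpperCopies`)

Lead seat `ym-line-fcl-p1` g2 (2026-08-28).  Route RED reduces its INNER NO-INTRUDER text over PHYSICAL families near the eight twisted pure-gauge orbits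
(`InnerNoIntruderAt`) to the ONE-ORBIT form over gauge-invariant families (`InnerNoIntruderOneOrbitAt`) — the Born–Oppenheimer analysis lives at one orbit.
The registered «Rate» skeleton of crux 23943 takes the physical-family INNER text WITH A RATE (`stub_innerRate`, consumed by the landed endgame
`boUpperRate_of_valley_innerRate`, `…FemtoCutoffLadderFixedLatticeLawRateGlue`).  This file shows RED's eight-copies reduction costs nothing at the rate level:

* `crossBound_eventually_small_sq` — the twisted cross terms are below `ε·λ_b(L³β)²·(uniformFloorConst·c_β^{|E|})` eventually, for every `ε > 0`
  (RED's `crossBound_eventually_small` with one more power of `β` against the exponential `e^{−βm²/(2|E|)}`);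
* ★★ `innerRate_of_oneOrbitRate` (level `k`): the one-orbit INNER NO-INTRUDER with tolerance `e^{C₁λ_b(L³β)²}` implies the physical-family INNER
  NO-INTRUDER with tolerance `e^{2(|C₁|+1)λ_b(L³β)²}` — RED's `innerNoIntruderAt_of_oneOrbit` verbatim at `ε := 2(|C₁|+1)·λ_b(L³β)` (`copies_endgame` is
  abstract in `ε`).
So a C4 prover who delivers the ONE-ORBIT Born–Oppenheimer comparison with an `O(λ_b²)` tolerance closes `stub_innerRate` by `exact`.
HONEST FRAMING: a reduction (bookkeeping); the one-orbit comparison with rate is OPEN (XL fixed-lattice semiclassics); femto rung R2b1 (RECORD label) — not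
infinite volume, not a mass gap, not Clay.  No definitions, no named facts, no `sorry`.
-/

set_option autoImplicit false

noncomputable section

open MeasureTheory Filter Topology Real
open scoped BigOperators
open Literature.MathematicalPhysics.QuantumFieldTheory hiding SU2
open Literature.MathematicalPhysics.QuantumLattice

namespace Summit.QuantumFields.YangMills.Theorems.FemtoCutoffLadder

open Summit.QuantumFields.YangMills.Theorems.FemtoTransferGap

variable {L : ℕ} [NeZero L]

/-- ★ **The cross terms are below `λ_b²`**: for `m > 0` and `ε > 0`, eventually in `β`,
`28 · crossBound L β m ≤ ε · λ_b(L³β)² · (uniformFloorConst L · c_β^{|E|})`. [folklore] -/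
theorem crossBound_eventually_small_sq {m : ℝ} (hm : 0 < m) {ε : ℝ} (hε : 0 < ε) :
    ∃ β0 : ℝ, ∀ β : ℝ, β0 ≤ β →
      28 * crossBound L β m ≤ ε * bareLambda ((L : ℝ) ^ 3 * β) ^ 2 * (uniformFloorConst L * latCE L β) := by
  have hL : (0 : ℝ) < L := by exact_mod_cast Nat.pos_of_ne_zero (NeZero.ne L)
  have hL1 : (1 : ℝ) ≤ (L : ℝ) ^ 3 := one_le_pow₀ (by exact_mod_cast NeZero.one_le)
  have hE0 : (0 : ℝ) < Fintype.card (Edge 3 L) := by exact_mod_cast Fintype.card_pos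
  have hcL := uniformFloorConst_pos (L := L)
  set w : ℝ := Real.exp (-(1 / 2 : ℝ)) * (8 / (3 * π ^ 3)) / 4 with hw
  have hw0 : 0 < w := by rw [hw]; positivity
  set K : ℝ := ε * (2 / (L : ℝ) ^ 3) ^ 2 * uniformFloorConst L * w ^ Fintype.card (Edge 3 L) / 28 with hK
  have hK0 : 0 < K := by rw [hK]; positivity
  set c : ℝ := m ^ 2 / (2 * Fintype.card (Edge 3 L)) with hc
  have hc0 : 0 < c := by rw [hc]; positivity
  obtain ⟨β0, hβ0⟩ := exists_pow_mul_exp_neg_le hc0 hK0 (2 * Fintype.card (Edge 3 L) + 2)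
  refine ⟨max 2 β0, fun β hβ => ?_⟩
  have hβ2 : 2 ≤ β := (le_max_left _ _).trans hβ
  have hβ1 : 1 ≤ β := by linarith
  have hβp : 0 < β := by linarith
  have hB2 : 2 ≤ (L : ℝ) ^ 3 * β := by nlinarith
  have hpow := hβ0 β ((le_max_right _ _).trans hβ)
  -- lower bound of the right-hand side
  have hlat := latCE_ge_poly (L := L) hβ1
  have hlam := two_div_le_bareLambda_cube (L := L) hB2
  have hlam2 : (2 / ((L : ℝ) ^ 3 * β)) ^ 2 ≤ bareLambda ((L : ℝ) ^ 3 * β) ^ 2 :=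
    pow_le_pow_left₀ (by positivity) hlam 2
  have e1 : (Real.exp (2 * β) * (Real.exp (-(1 / 2 : ℝ)) * (8 / (3 * π ^ 3)) / (4 * β ^ 2))) ^ Fintype.card (Edge 3 L) =
      Real.exp (2 * β) ^ Fintype.card (Edge 3 L) * w ^ Fintype.card (Edge 3 L) / (β ^ 2) ^ Fintype.card (Edge 3 L) := by
    rw [hw, ← mul_pow, ← div_pow]; congr 1; field_simp
  rw [e1] at hlat
  have hR : ε * (2 / ((L : ℝ) ^ 3 * β)) ^ 2 * (uniformFloorConst L * (Real.exp (2 * β) ^ Fintype.card (Edge 3 L) * w ^ Fintype.card (Edge 3 L) /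
      (β ^ 2) ^ Fintype.card (Edge 3 L))) ≤ ε * bareLambda ((L : ℝ) ^ 3 * β) ^ 2 * (uniformFloorConst L * latCE L β) := by
    have h1 : ε * (2 / ((L : ℝ) ^ 3 * β)) ^ 2 ≤ ε * bareLambda ((L : ℝ) ^ 3 * β) ^ 2 := mul_le_mul_of_nonneg_left hlam2 hε.le
    exact mul_le_mul h1 (mul_le_mul_of_nonneg_left hlat hcL.le) (mul_nonneg hcL.le (by positivity)) (mul_nonneg hε.le (sq_nonneg _))
  -- upper bound of the left-hand side
  have hexp : Real.exp (-(c * β)) ≤ K / β ^ (2 * Fintype.card (Edge 3 L) + 2) := by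
    rw [le_div_iff₀ (by positivity), mul_comm]; exact hpow
  have hLHS : 28 * crossBound L β m = 28 * Real.exp (2 * β) ^ Fintype.card (Edge 3 L) * Real.exp (-(c * β)) := by
    have e : β / 2 * (m ^ 2 / Fintype.card (Edge 3 L)) = c * β := by rw [hc]; field_simp
    unfold crossBound
    rw [e]; ring
  rw [hLHS]
  refine le_trans (mul_le_mul_of_nonneg_left hexp (by positivity)) (le_trans (le_of_eq ?_) hR)
  rw [hK, pow_add, ← pow_mul]
  field_simp

/-- ★★ **INNER NO-INTRUDER WITH RATE from its one-orbit form** (level `k`): if, eventually in `β`, every family `G₀…G_k` of bounded measurable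
GAUGE-invariant functions supported in `{orbitDist U < δ(β)}` with nondegenerate Gram matrix has a combination with
`⟨ψ,Kψ⟩·μ₀ ≤ e^{C₁λ_b(L³β)²}·μ_k·λ₀·‖ψ‖²`, then (for positive scales eventually `≤ 1/(2L)`) the same holds for PHYSICAL families supported in the union of
the eight twisted neighbourhoods, with tolerance `e^{2(|C₁|+1)λ_b(L³β)²}`.  RED's `innerNoIntruderAt_of_oneOrbit` at `ε := 2(|C₁|+1)λ_b(L³β)`.
[cite: Luscher1983, §3] -/
theorem innerRate_of_oneOrbitRate (k : ℕ) {δ : ℝ → ℝ} (hδ : ∀ β, 0 < δ β)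
    (hδL : ∃ β1 : ℝ, ∀ β : ℝ, β1 ≤ β → δ β ≤ 1 / (2 * L))
    (hI1 : ∃ C₁ βI : ℝ, ∀ β : ℝ, βI ≤ β →
      ∀ G : Fin (k + 1) → (GaugeConfig 3 L SU2 → ℝ),
        (∀ i, Measurable (G i)) → (∀ i, ∃ C : ℝ, ∀ U, |G i U| ≤ C) →
        (∀ i (g : Site 3 L → SU2) (U : GaugeConfig 3 L SU2), G i (gaugeTransform g U) = G i U) →
        (∀ i U, G i U ≠ 0 → orbitDist U < δ β) →
        (∀ a : Fin (k + 1) → ℝ, a ≠ 0 → 0 < l2 (fun U => ∑ i, a i * G i U) (fun U => ∑ i, a i * G i U)) →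
          ∃ a : Fin (k + 1) → ℝ, a ≠ 0 ∧
            qform su2Rep β (fun U => ∑ i, a i * G i U) (fun U => ∑ i, a i * G i U) * levelValue su2Rep 1 ((L : ℝ) ^ 3 * β) 0 ≤
              Real.exp (C₁ * bareLambda ((L : ℝ) ^ 3 * β) ^ 2) * levelValue su2Rep 1 ((L : ℝ) ^ 3 * β) k * levelValue su2Rep L β 0 *
                l2 (fun U => ∑ i, a i * G i U) (fun U => ∑ i, a i * G i U)) :
    ∃ C βI : ℝ, ∀ β : ℝ, βI ≤ β →
      ∀ F : Fin (k + 1) → (GaugeConfig 3 L SU2 → ℝ), (∀ i, IsPhys (F i)) →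
        (∀ i U, F i U ≠ 0 → ∃ z : Fin 3 → Bool, orbitDist (TT.twist3 z U) < δ β) →
        (∀ a : Fin (k + 1) → ℝ, a ≠ 0 → 0 < l2 (fun U => ∑ i, a i * F i U) (fun U => ∑ i, a i * F i U)) →
          ∃ a : Fin (k + 1) → ℝ, a ≠ 0 ∧
            qform su2Rep β (fun U => ∑ i, a i * F i U) (fun U => ∑ i, a i * F i U) * levelValue su2Rep 1 ((L : ℝ) ^ 3 * β) 0 ≤
              Real.exp (C * bareLambda ((L : ℝ) ^ 3 * β) ^ 2) * levelValue su2Rep 1 ((L : ℝ) ^ 3 * β) k *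
                levelValue su2Rep L β 0 * l2 (fun U => ∑ i, a i * F i U) (fun U => ∑ i, a i * F i U) := by
  have hL : (0 : ℝ) < L := by exact_mod_cast Nat.pos_of_ne_zero (NeZero.ne L)
  have hL1 : (1 : ℝ) ≤ (L : ℝ) ^ 3 := one_le_pow₀ (by exact_mod_cast NeZero.one_le)
  obtain ⟨C1, B0, hONE⟩ := oneSiteLevels_proof k
  obtain ⟨CI, βI, hI1'⟩ := hI1
  obtain ⟨C', hC'⟩ : ∃ C' : ℝ, C' = |CI| + 1 := ⟨_, rfl⟩
  have hC'0 : 0 < C' := by rw [hC']; positivity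
  have hCC' : CI ≤ C' := by rw [hC']; linarith [le_abs_self CI]
  obtain ⟨β1, hδ1⟩ := hδL
  obtain ⟨βs, hs⟩ := crossBound_eventually_small_sq (L := L) (m := 1 / (2 * L)) (by positivity) (by positivity : (0 : ℝ) < 2 * C')
  have hτ0 : 0 < 1 / (2 * (|levelGap k| + |C1| + 2)) := by positivity
  refine ⟨2 * C', max (max (max 1 B0) (max βI β1)) (max βs (2 / (1 / (2 * (|levelGap k| + |C1| + 2))) ^ 3)), fun β hβ => ?_⟩
  have hβ1 : 1 ≤ β := (((le_max_left _ _).trans (le_max_left _ _)).trans (le_max_left _ _)).trans hβ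
  have hβ0 : 0 < β := by linarith
  have hβB0 : B0 ≤ β := (((le_max_right _ _).trans (le_max_left _ _)).trans (le_max_left _ _)).trans hβ
  have hβI : βI ≤ β := (((le_max_left _ _).trans (le_max_right _ _)).trans (le_max_left _ _)).trans hβ
  have hβd : β1 ≤ β := (((le_max_right _ _).trans (le_max_right _ _)).trans (le_max_left _ _)).trans hβ
  have hβs : βs ≤ β := ((le_max_left _ _).trans (le_max_right _ _)).trans hβ
  have hβτ : 2 / (1 / (2 * (|levelGap k| + |C1| + 2))) ^ 3 ≤ β := ((le_max_right _ _).trans (le_max_right _ _)).trans hβ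
  intro F hF hsupp hGram
  -- geometry of the scales
  have hδ0 := hδ β
  have hδ2 : δ β ≤ 1 / (2 * L) := hδ1 β hβd
  have hLδ : (L : ℝ) * δ β < 2 := by
    have := mul_le_mul_of_nonneg_left hδ2 hL.le
    have e : (L : ℝ) * (1 / (2 * L)) = 1 / 2 := by field_simp
    linarith
  have hLm : (L : ℝ) * (δ β + 1 / (2 * L)) < 2 := by
    have := mul_le_mul_of_nonneg_left hδ2 hL.le
    have e : (L : ℝ) * (1 / (2 * L)) = 1 / 2 := by field_simp
    nlinarith
  -- one-site data
  have hB'β : β ≤ (L : ℝ) ^ 3 * β := by nlinarith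
  have hB'0 : 0 < (L : ℝ) ^ 3 * β := lt_of_lt_of_le hβ0 hB'β
  obtain ⟨hμ0, -, hμk⟩ := hONE ((L : ℝ) ^ 3 * β) (hβB0.trans hB'β)
  have hlam0 : 0 < bareLambda ((L : ℝ) ^ 3 * β) := bareLambda_pos' hB'0
  have hlamτ := bareLambda_cube_le (L := L) hτ0 hβτ
  obtain ⟨-, -, hy⟩ := smallness_of_le hlam0.le hlamτ
  have hμk' : Real.exp (-(levelGap k * bareLambda ((L : ℝ) ^ 3 * β) + |C1| * bareLambda ((L : ℝ) ^ 3 * β) ^ 2)) *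
      levelValue su2Rep 1 ((L : ℝ) ^ 3 * β) 0 ≤ levelValue su2Rep 1 ((L : ℝ) ^ 3 * β) k := by
    refine le_trans (mul_le_mul_of_nonneg_right (Real.exp_le_exp.2 ?_) hμ0.le) hμk
    have := mul_le_mul_of_nonneg_right (le_abs_self C1) (sq_nonneg (bareLambda ((L : ℝ) ^ 3 * β)))
    linarith
  have hμk2 := half_le_of_exp_lower hy hμ0.le hμk'
  have hΛ0 : 0 < levelValue su2Rep L β 0 := levelValue_su2Rep_pos hβ0 0
  -- the cross terms fit under `ε·λ` with `ε = 2C'λ`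
  have hsc : 28 * crossBound L β (1 / (2 * L)) ≤
      2 * C' * bareLambda ((L : ℝ) ^ 3 * β) * bareLambda ((L : ℝ) ^ 3 * β) * levelValue su2Rep L β 0 := by
    refine (hs β hβs).trans ?_
    rw [show 2 * C' * bareLambda ((L : ℝ) ^ 3 * β) ^ 2 = 2 * C' * bareLambda ((L : ℝ) ^ 3 * β) * bareLambda ((L : ℝ) ^ 3 * β) by ring]
    exact mul_le_mul_of_nonneg_left (levelValue_zero_ge_uniform hβ1) (by positivity)
  -- the one-orbit cut family
  choose C hC using fun i => (hF i).bounded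
  obtain ⟨G, hGdef⟩ : ∃ G : Fin (k + 1) → GaugeConfig 3 L SU2 → ℝ, G = fun i => orbitCut (δ β) (F i) := ⟨_, rfl⟩
  have hGm : ∀ i, Measurable (G i) := fun i => by rw [hGdef]; exact measurable_orbitCut _ (hF i).measurable
  have hGb : ∀ i, ∃ C' : ℝ, ∀ U, |G i U| ≤ C' := fun i => ⟨C i, fun U => by rw [hGdef]; exact abs_orbitCut_le _ (hC i) U⟩
  have hGg : ∀ i (g : Site 3 L → SU2) (U : GaugeConfig 3 L SU2), G i (gaugeTransform g U) = G i U := fun i g U => by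
    rw [hGdef]; exact orbitCut_gaugeTransform _ (hF i).gaugeInv g U
  have hGs : ∀ i U, G i U ≠ 0 → orbitDist U < δ β := fun i U h => by
    rw [hGdef] at h; exact orbitDist_lt_of_orbitCut_ne_zero h
  -- combinations: `Σ aᵢFᵢ = twistSum (Σ aᵢGᵢ)`
  have hcomb : ∀ a : Fin (k + 1) → ℝ, (fun U => ∑ i, a i * F i U) = twistSum (fun U => ∑ i, a i * G i U) := fun a => by
    rw [twistSum_sum_mul]
    funext U
    refine Finset.sum_congr rfl fun i _ => ?_
    rw [hGdef, twistSum_orbitCut hLδ (hF i) (hsupp i)]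
  have hφm : ∀ a : Fin (k + 1) → ℝ, Measurable fun U => ∑ i, a i * G i U := fun a => by
    rw [hGdef]; exact measurable_sum_mul_orbitCut _ a fun i => (hF i).measurable
  have hφb : ∀ (a : Fin (k + 1) → ℝ) U, |∑ i, a i * G i U| ≤ ∑ i, |a i| * C i := fun a U => by
    rw [hGdef]; exact abs_sum_mul_orbitCut_le _ a hC U
  have hφs : ∀ (a : Fin (k + 1) → ℝ) U, ∑ i, a i * G i U ≠ 0 → orbitDist U < δ β := fun a U h => by
    rw [hGdef] at h; exact orbitDist_lt_of_sum_mul_orbitCut_ne_zero a F h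
  have hl2 : ∀ a : Fin (k + 1) → ℝ, l2 (fun U => ∑ i, a i * F i U) (fun U => ∑ i, a i * F i U) =
      8 * l2 (fun U => ∑ i, a i * G i U) (fun U => ∑ i, a i * G i U) := fun a => by
    rw [hcomb a]; exact l2_twistSum (hφm a) (hφb a) hLδ (hφs a)
  have hq : ∀ a : Fin (k + 1) → ℝ, qform su2Rep β (fun U => ∑ i, a i * F i U) (fun U => ∑ i, a i * F i U) ≤
      8 * qform su2Rep β (fun U => ∑ i, a i * G i U) (fun U => ∑ i, a i * G i U) +
        56 * (crossBound L β (1 / (2 * L)) * l2 (fun U => ∑ i, a i * G i U) (fun U => ∑ i, a i * G i U)) := fun a => by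
    rw [hcomb a]
    have h := abs_qform_twistSum_sub_le hβ0.le (hφm a) (hφb a) (by positivity : (0 : ℝ) ≤ 1 / (2 * L)) hLm (hφs a)
    rw [abs_le] at h
    linarith [h.2]
  -- Gram nondegeneracy transfers
  have hGramG : ∀ a : Fin (k + 1) → ℝ, a ≠ 0 → 0 < l2 (fun U => ∑ i, a i * G i U) (fun U => ∑ i, a i * G i U) := fun a ha => by
    have h := hGram a ha
    rw [hl2 a] at h
    linarith
  -- apply I₁ with rate, convert `e^{C_I λ²} ≤ e^{(ε/2)λ}` with `ε = 2C'λ`, and conclude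
  obtain ⟨a, ha, hIa⟩ := hI1' β hβI G hGm hGb hGg hGs hGramG
  have hnG := l2_self_nonneg_lat (fun U => ∑ i, a i * G i U)
  have hIa' : qform su2Rep β (fun U => ∑ i, a i * G i U) (fun U => ∑ i, a i * G i U) * levelValue su2Rep 1 ((L : ℝ) ^ 3 * β) 0 ≤
      Real.exp (2 * C' * bareLambda ((L : ℝ) ^ 3 * β) / 2 * bareLambda ((L : ℝ) ^ 3 * β)) *
        levelValue su2Rep 1 ((L : ℝ) ^ 3 * β) k * levelValue su2Rep L β 0 *
          l2 (fun U => ∑ i, a i * G i U) (fun U => ∑ i, a i * G i U) := by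
    refine hIa.trans ?_
    have hμkpos : 0 ≤ levelValue su2Rep 1 ((L : ℝ) ^ 3 * β) k := le_trans (by positivity) hμk'
    have hexpI : Real.exp (CI * bareLambda ((L : ℝ) ^ 3 * β) ^ 2) ≤
        Real.exp (2 * C' * bareLambda ((L : ℝ) ^ 3 * β) / 2 * bareLambda ((L : ℝ) ^ 3 * β)) := by
      rw [Real.exp_le_exp]
      have := mul_le_mul_of_nonneg_right hCC' (sq_nonneg (bareLambda ((L : ℝ) ^ 3 * β)))
      nlinarith
    exact mul_le_mul_of_nonneg_right (mul_le_mul_of_nonneg_right (mul_le_mul_of_nonneg_right hexpI hμkpos) hΛ0.le) hnG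
  refine ⟨a, ha, ?_⟩
  rw [hl2 a, show 2 * C' * bareLambda ((L : ℝ) ^ 3 * β) ^ 2 = 2 * C' * bareLambda ((L : ℝ) ^ 3 * β) * bareLambda ((L : ℝ) ^ 3 * β) by ring]
  exact copies_endgame hnG hμ0.le hΛ0.le hlam0.le (by positivity : (0 : ℝ) ≤ 2 * C' * bareLambda ((L : ℝ) ^ 3 * β))
    hμk2 (hq a) hIa' hsc

end Summit.QuantumFields.YangMills.Theorems.FemtoCutoffLadder

end
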